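import Summits.AtomisticToContinuum.HydrodynamicLimit.Theses.JParityClosure

/-!
# Line `pt-shadow-flux-detailed-balance` — crux `JParityClosure.OddContactSymmetry`
(stmt-AtomisticToContinuum-13078)

Skeleton (crux-plan, round 1) of idea card `pt-shadow-flux-detailed-balance` (ideator 1, triage r1-1:
pass). LEVER: the position reflection `R̂ : (x, v) ↦ (−x, v)` (velocities untouched) is a REVERSING
symmetry of hard-sphere dynamics (`R̂ ∘ Φ_t = Φ_{−t} ∘ R̂`: free flight and `reflectVel (−n) = reflectVel n`
commute with it), and its trace on the contact data of a collision is exactly the route's inverse-collision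
involution `J (n̂, v, w) = (−n̂, v′, w′)` (`J = ρ ∘ C`, `C` = pre ↦ post of the same collision, free;
`ρ` = fore–aft flip `n̂ ↦ −n̂`). Hence for a flow-stationary `R̂`-invariant local state the pre-collisional
contact intensity is `J`-invariant (UNTWISTED detailed balance, "FluxDB") — with no chaos, no factorisation,
no Gibbs classification — and every `J`-odd UNWEIGHTED mark has vanishing per-collision mean. The crux
statistic is the `(1 + e^{−F})`-REWEIGHTED odd mark; the reweighting is asymptotically the constant `2`
exactly when the local one-body velocity law is Maxwellian (`F = 0` on the collision support), so
`crux ⟸ FluxDB ∧ (M)`, the card's split (given the route's `RateFloor` it is an equivalence).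

The four registered stubs are the finite-`N`, in-probability shadows of that split, typed in the crux's own
dialect (same mollifiers, same collision functional `K_N`, same local Gibbs law):

* `stub_localMaxwellReweighting` — the `(M)` half: `K_N[χ g m (1+e^{−F})] − 2 K_N[χ g m] → 0` in probability
  for EVERY bounded continuous mark `m` (parity-free; the route's balance node / card
  `rate-sandwich-isolated-maxwellians`; not this line's mechanism, imported honestly).
* `stub_pairForeAftSymmetry` — THE BET `(R̂)` read on pairs (no PT-breaking in forward local-Gibbs local
  states): the microscopic pair functional `P_N[χ g f]` is asymptotically invariant under the fore–aft
  reflection `f ↦ f ∘ ρ₁`, `ρ₁ (y, v, w) = (−y, v, w)`, for every `f ∈ C_c(ℝ³ × ℝ³ × ℝ³)`. HARDEST.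
* `stub_collisionEnergyTails` — collisions with a fast incoming particle carry vanishing normalised weight.
* `stub_tubeRepresentation` — `(E)`-bookkeeping, fore–aft covariant: given the tails, for every bounded
  continuous mark `m` there is ONE test function `f ∈ C_c` (a truncated, mollified free-flight collision TUBE)
  whose pair functional represents the pre-collisional reading `K_N[χ g m]` and whose mirror `f ∘ ρ₁`
  represents the `J`-reading `K_N^J[χ g m] = K_N[χ g (m ∘ J)]` (each collision read through `(−n̂, v⁺, w⁺)`),
  both up to `o_P(1)` — because reflecting positions and running free flight forward IS running it backward.

Composition (sorry-free): `K_N^J[χ g Ψ] = −K_N[χ g Ψ]` identically for a `J`-odd `Ψ` (the crux's oddness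
hypothesis + `reflectVel_smul`, `reflectVel_reflectVel`); so symmetry + representation squeeze
`2 K_N[χ g Ψ] → 0`, and `(M)` turns `K_N[χ g Ψ (1+e^{−F})]` into `2 K_N[χ g Ψ]`: a four-event union bound
(`measure_setOf_lt_abs_le`). `OddContactSymmetry_of` concludes the crux BY NAME; the bridge
`oddContactSymmetry_iff` (by `Iff.rfl`) certifies that the local vocabulary is the crux's verbatim.

Disproof used: none — no `Disproof.lean` exists for this crux at planning time (2026-08-15; `ledger crux ls`:
Ideas + TRIAGE-r1-1 only); no `_false_without_` obstruction and no landed `Negative/` lemma to honour yet.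
-/

noncomputable section

open scoped BigOperators Topology Manifold Classical MeasureTheory ProbabilityTheory Matrix InnerProductSpace ComplexConjugate ContinuousMap ENNReal
open Filter Set Function TopologicalSpace MeasureTheory

namespace Summit.AtomisticToContinuum.HydrodynamicLimit.Cruxes.OddContactSymmetry.PtShadowFluxDetailedBalance

open Literature.MathematicalPhysics.KineticTheory (T3 V3 hsDiameter localGibbsLaw hsDiameter_pos)
open Literature.Analysis.FluidPDE (HardSphereFlow Config reflectVel empiricalMeasure localMaxwellian
  collisionTimes reflectVel_smul reflectVel_reflectVel)
open Summit.AtomisticToContinuum.HydrodynamicLimit.Theses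

/-! ## The crux's vocabulary as definitions (verbatim the inline `let`s of `OddContactSymmetry`) -/

/-- The hard-sphere geometry of the flat `3`-torus (the crux's `G`). -/
abbrev G3 : Literature.Analysis.FluidPDE.Geometry (Fin 3) T3 :=
  Literature.Analysis.FluidPDE.Torus.geometry (Fin 3)

/-- Hard-sphere flows of `N + 1` spheres at reduced density `σ` (the crux's `Φ N`). -/
abbrev Flow (σ : ℝ) (N : ℕ) : Type := HardSphereFlow G3 (hsDiameter σ N) (N + 1)

/-- `(N+1)`-particle configurations on `𝕋³`. -/
abbrev Cfg (N : ℕ) : Type := Config (N + 1) (Fin 3) T3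

/-- The `r`-ball mollifier `b_r(x, y) = 3/(π r³) · (1 − d(x, y)/r)₊` (the crux's `bx`). -/
def ball (r : ℝ) (x y : T3) : ℝ :=
  3 / (Real.pi * r ^ 3) * max (1 - Literature.Analysis.FluidPDE.Torus.euclidDist x y / r) 0

/-- `ρ_r(w)(x₀)`: the `r`-mollified empirical density of the configuration `w` at `x₀` (the crux's `ρm`). -/
def rhoMoll {N : ℕ} (r : ℝ) (w : Cfg N) (x₀ : T3) : ℝ :=
  ∫ q, ball r q.1 x₀ ∂(empiricalMeasure w)

/-- `h_{r,ϑ}(w)(x₀, v)`: the empirical one-particle law of `w` mollified at space scale `r` and velocity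
scale `ϑ` (the crux's `hm`). -/
def hMoll {N : ℕ} (r ϑ : ℝ) (w : Cfg N) (x₀ : T3) (v : V3) : ℝ :=
  ∫ q, ball r q.1 x₀ * localMaxwellian 1 (ϑ ^ 2) v q.2 ∂(empiricalMeasure w)

/-- Pre-collisional velocities `(v⁻, w⁻)` of the ordered pair `(i, j)` of a right-continuous (hence
post-collisional) configuration (the crux's `pv`). -/
def preVel {N : ℕ} (w : Cfg N) (i j : Fin (N + 1)) : V3 × V3 :=
  reflectVel (G3.sepVec (w i).1 (w j).1) ((w i).2, (w j).2)

/-- The unit contact direction `n̂ = ε⁻¹ (x_i − x_j)` (minimal image), `ε = hsDiameter σ N`. -/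
def unitSep (σ : ℝ) (N : ℕ) (w : Cfg N) (i j : Fin (N + 1)) : V3 :=
  (hsDiameter σ N)⁻¹ • G3.sepVec (w i).1 (w j).1

/-- Pre-collisional contact data `(n̂, v⁻, w⁻)` — the argument of the marks of `K_N`. -/
def preData (σ : ℝ) (N : ℕ) (w : Cfg N) (i j : Fin (N + 1)) : V3 × V3 × V3 :=
  (unitSep σ N w i j, (preVel w i j).1, (preVel w i j).2)

/-- The `J`-image `J (n̂, v⁻, w⁻) = (−n̂, v⁺, w⁺)` of the pre-collisional data, read off the post-collisional
configuration: the contact data of the `R̂`-reflected, time-reversed collision. -/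
def revData (σ : ℝ) (N : ℕ) (w : Cfg N) (i j : Fin (N + 1)) : V3 × V3 × V3 :=
  (-unitSep σ N w i j, (w i).2, (w j).2)

/-- The surprisal jump `F = log h(v⁻) + log h(w⁻) − log h(v⁺) − log h(w⁺)`, `h = h_{r,ϑ}` at `x_i`
(the crux's `F`). -/
def surprisal {N : ℕ} (r ϑ : ℝ) (w : Cfg N) (i j : Fin (N + 1)) : ℝ :=
  Real.log (hMoll r ϑ w (w i).1 (preVel w i j).1) + Real.log (hMoll r ϑ w (w i).1 (preVel w i j).2) -
    Real.log (hMoll r ϑ w (w i).1 (w i).2) - Real.log (hMoll r ϑ w (w i).1 (w j).2)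

/-- The normalised collision functional of the route statements (the crux's `Kc`):
`K_N[M](z) = (ε/(N+1)) Σ_{collision times s ∈ [0, τ]} Σ_{ordered contact pairs (i, j)} M z s i j`. -/
def collSum (σ : ℝ) (N : ℕ) (Φ : Flow σ N) (τ : ℝ) (M : Cfg N → ℝ → Fin (N + 1) → Fin (N + 1) → ℝ)
    (z : Cfg N) : ℝ :=
  hsDiameter σ N / (N + 1 : ℝ) *
    ∑ᶠ (s : ℝ) (_ : s ∈ collisionTimes G3 (hsDiameter σ N) (fun s => Φ.flow s z) ∩ Set.Icc 0 τ),
      ∑ i : Fin (N + 1), ∑ j : Fin (N + 1),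
        (if i ≠ j ∧ ‖G3.sepVec (Φ.flow s z i).1 (Φ.flow s z j).1‖ = hsDiameter σ N then M z s i j else 0)

/-- `K_N[χ g m]`: the UNWEIGHTED pre-collisional reading of the mark `m` (weight `χ(s, x_i) g(σ³ρ_r(s, x_i))`). -/
def preStat (σ : ℝ) (N : ℕ) (Φ : Flow σ N) (τ : ℝ) (χ : ℝ × T3 → ℝ) (g : ℝ → ℝ) (m : V3 × V3 × V3 → ℝ)
    (r : ℝ) (z : Cfg N) : ℝ :=
  collSum σ N Φ τ (fun z s i j => χ (s, (Φ.flow s z i).1) * g (σ ^ 3 * rhoMoll r (Φ.flow s z) (Φ.flow s z i).1) *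
    m (preData σ N (Φ.flow s z) i j)) z

/-- `K_N^J[χ g m]`: every collision read through `J(pre) = (−n̂, v⁺, w⁺)` (so `K_N^J[χ g m] = K_N[χ g (m ∘ J)]`). -/
def revStat (σ : ℝ) (N : ℕ) (Φ : Flow σ N) (τ : ℝ) (χ : ℝ × T3 → ℝ) (g : ℝ → ℝ) (m : V3 × V3 × V3 → ℝ)
    (r : ℝ) (z : Cfg N) : ℝ :=
  collSum σ N Φ τ (fun z s i j => χ (s, (Φ.flow s z i).1) * g (σ ^ 3 * rhoMoll r (Φ.flow s z) (Φ.flow s z i).1) *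
    m (revData σ N (Φ.flow s z) i j)) z

/-- The crux statistic `K_N[χ g m (1 + e^{−F})]` (the crux's `D`, for a general mark `m`). -/
def reweightedStat (σ : ℝ) (N : ℕ) (Φ : Flow σ N) (τ : ℝ) (χ : ℝ × T3 → ℝ) (g : ℝ → ℝ)
    (m : V3 × V3 × V3 → ℝ) (r ϑ : ℝ) (z : Cfg N) : ℝ :=
  collSum σ N Φ τ (fun z s i j => χ (s, (Φ.flow s z i).1) * g (σ ^ 3 * rhoMoll r (Φ.flow s z) (Φ.flow s z i).1) *
    (m (preData σ N (Φ.flow s z) i j) * (1 + Real.exp (-surprisal r ϑ (Φ.flow s z) i j)))) z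

/-- The fore–aft reflection `ρ₁ (y, v, w) = (−y, v, w)` of pair data: positions reflected, velocities kept —
`R̂` read on a pair; on contact data it is the flip `n̂ ↦ −n̂`, and `J = ρ₁ ∘ C`. -/
def foreAft (f : V3 × V3 × V3 → ℝ) : V3 × V3 × V3 → ℝ := fun q => f (-q.1, q.2.1, q.2.2)

/-- The microscopic PAIR functional
`P_N[χ g f](z) = ∫₀^τ (N+1)⁻¹ Σ_{i ≠ j} χ(s, x_i) g(σ³ρ_r(s, x_i)) f(ε⁻¹(x_i − x_j), v_i, v_j) ds`
(instantaneous velocities; `f` compactly supported in the blown-up separation sees `O(1)` partners per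
particle by the hard core, so `P_N = O(τ ‖f‖)` surely). -/
def pairStat (σ : ℝ) (N : ℕ) (Φ : Flow σ N) (τ : ℝ) (χ : ℝ × T3 → ℝ) (g : ℝ → ℝ) (f : V3 × V3 × V3 → ℝ)
    (r : ℝ) (z : Cfg N) : ℝ :=
  ∫ s in Set.Icc (0 : ℝ) τ, (N + 1 : ℝ)⁻¹ * ∑ i : Fin (N + 1), ∑ j : Fin (N + 1),
    (if i ≠ j then χ (s, (Φ.flow s z i).1) * g (σ ^ 3 * rhoMoll r (Φ.flow s z) (Φ.flow s z i).1) *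
      f (unitSep σ N (Φ.flow s z) i j, (Φ.flow s z i).2, (Φ.flow s z j).2) else 0)

/-! ## The bridge: the crux, verbatim, in this vocabulary -/

/-- `OddContactSymmetry` is, definitionally, the statement that the reweighted odd statistic
`reweightedStat` is small in probability under the local Gibbs law (same quantifier prefix; the inline
`let`s of the route decl are the definitions above). -/
theorem oddContactSymmetry_iff :
    JParityClosure.OddContactSymmetry ↔
    ∃ η₀ : ℝ, 0 < η₀ ∧ ∀ (a₀ θ₀ : Literature.MathematicalPhysics.KineticTheory.T3 → ℝ) (u₀ : Literature.MathematicalPhysics.KineticTheory.T3 → Literature.MathematicalPhysics.KineticTheory.V3), Continuous a₀ → Continuous θ₀ → Continuous u₀ → (∀ x, 0 < a₀ x) → (∀ x, 0 < θ₀ x) → ∃ σ₀ : ℝ, 0 < σ₀ ∧ ∀ σ : ℝ, 0 < σ → σ < σ₀ → ∀ Φ : (N : ℕ) → Literature.Analysis.FluidPDE.HardSphereFlow (Literature.Analysis.FluidPDE.Torus.geometry (Fin 3)) (Literature.MathematicalPhysics.KineticTheory.hsDiameter σ N) (N + 1), ∀ τ : ℝ, 0 < τ → ∀ χ : ℝ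 × UnitAddTorus (Fin 3) → ℝ, Continuous χ → ∀ g : ℝ → ℝ, Continuous g → (∀ a, η₀ ≤ a → g a = 0) → ∀ Ψ : EuclideanSpace ℝ (Fin 3) × EuclideanSpace ℝ (Fin 3) × EuclideanSpace ℝ (Fin 3) → ℝ, Continuous Ψ → (∃ C : ℝ, ∀ q, |Ψ q| ≤ C) → (∀ (n v w : EuclideanSpace ℝ (Fin 3)), ‖n‖ = 1 → Ψ (-n, (Literature.Analysis.FluidPDE.reflectVel n (v, w)).1, (Literature.Analysis.FluidPDE.reflectVel n (v, w)).2) = -Ψ (n, v, w)) → ∀ η δ : ℝ, 0 < η → 0 < δ → ∃ r₀ : ℝ, 0 < r₀ ∧ ∀ r ϑ : ℝ, 0 < r → r < r₀ → 0 < ϑ → ϑ < r₀ → ∃ N₀ : ℕ, ∀ N : ℕ, N₀ ≤ N →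
      localGibbsLaw σ a₀ u₀ θ₀ N (Φ N) {z | η < |reweightedStat σ N (Φ N) τ χ g Ψ r ϑ z|} ≤ ENNReal.ofReal δ :=
  Iff.rfl

/-! ## The four stub STATEMENTS (named `Prop`s) -/

/-- Statement of `stub_localMaxwellReweighting` — the `(M)` half of the split (LOCAL MAXWELLIANITY read through
collisions; parity-free). Along forward local-Gibbs evolutions at small reduced density, below a packing
cutoff `η₀`, the surprisal reweighting `1 + e^{−F}` acts asymptotically as the constant `2` on EVERY bounded
continuous mark: `K_N[χ g m (1 + e^{−F})] − 2 K_N[χ g m] → 0` in probability (`N → ∞` at fixed mollification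
scales `r, ϑ < r₀`). Equivalently `K_N[χ g m (e^{−F} − 1)] → 0`: `e^{−F} = h(v⁺)h(w⁺)/(h(v⁻)h(w⁻)) → 1` on the
collision support, i.e. `log h` is a collision invariant there — the local velocity law is Maxwellian wherever
collisions happen (with the route's `RateFloor`: everywhere). This is the route's balance-direction node
(`LocalVelocityEquilibration` of the two-layer plan; card `rate-sandwich-isolated-maxwellians`), not the
parity mechanism; it is what the lever explicitly does NOT provide. -/
def LocalMaxwellReweighting : Prop :=
  ∃ η₀ : ℝ, 0 < η₀ ∧ ∀ (a₀ θ₀ : T3 → ℝ) (u₀ : T3 → V3), Continuous a₀ → Continuous θ₀ → Continuous u₀ →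
    (∀ x, 0 < a₀ x) → (∀ x, 0 < θ₀ x) → ∃ σ₀ : ℝ, 0 < σ₀ ∧ ∀ σ : ℝ, 0 < σ → σ < σ₀ →
    ∀ Φ : (N : ℕ) → Flow σ N, ∀ τ : ℝ, 0 < τ → ∀ χ : ℝ × T3 → ℝ, Continuous χ →
    ∀ g : ℝ → ℝ, Continuous g → (∀ a, η₀ ≤ a → g a = 0) →
    ∀ m : V3 × V3 × V3 → ℝ, Continuous m → (∃ C : ℝ, ∀ q, |m q| ≤ C) →
    ∀ η δ : ℝ, 0 < η → 0 < δ → ∃ r₀ : ℝ, 0 < r₀ ∧ ∀ r ϑ : ℝ, 0 < r → r < r₀ → 0 < ϑ → ϑ < r₀ →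
    ∃ N₀ : ℕ, ∀ N : ℕ, N₀ ≤ N →
      localGibbsLaw σ a₀ u₀ θ₀ N (Φ N)
        {z | η < |reweightedStat σ N (Φ N) τ χ g m r ϑ z - 2 * preStat σ N (Φ N) τ χ g m r z|} ≤
        ENNReal.ofReal δ

/-- Statement of `stub_pairForeAftSymmetry` — THE BET `(R̂)`, read on pairs: NO PT-BREAKING in forward
local-Gibbs local states. Along forward local-Gibbs evolutions at small reduced density, below a packing
cutoff, the microscopic pair functional is asymptotically invariant under the fore–aft reflection of the
blown-up separation at fixed velocities: `P_N[χ g f] − P_N[χ g (f ∘ ρ₁)] → 0` in probability (`N → ∞` at fixed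
`r < r₀`) for every continuous compactly supported `f (ε⁻¹(x_i − x_j), v_i, v_j)`. This is the finite-`N`
trace on two-point statistics of "every local weak limit of the space–time local states
(`Literature.Analysis.FluidPDE.localLawTimeAvg`, `rootedLocalState`) is `R̂`-invariant, `R̂ : (x, v) ↦ (−x, v)`";
`R̂`-invariance is linear, weak*-closed, convex and velocity-blind, true for every Gibbs state at every density
and on the formal kernel of the Boltzmann-hypothesis barrier (ideal gas `⊗ h`, hard rods `(ρ, h)`), false only
for HANDED stationary states; smooth Euler is PT-symmetric, Navier–Stokes is not, so the statement lives at
`Kn = 0` exactly as the crux does. -/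
def PairForeAftSymmetry : Prop :=
  ∃ η₀ : ℝ, 0 < η₀ ∧ ∀ (a₀ θ₀ : T3 → ℝ) (u₀ : T3 → V3), Continuous a₀ → Continuous θ₀ → Continuous u₀ →
    (∀ x, 0 < a₀ x) → (∀ x, 0 < θ₀ x) → ∃ σ₀ : ℝ, 0 < σ₀ ∧ ∀ σ : ℝ, 0 < σ → σ < σ₀ →
    ∀ Φ : (N : ℕ) → Flow σ N, ∀ τ : ℝ, 0 < τ → ∀ χ : ℝ × T3 → ℝ, Continuous χ →
    ∀ g : ℝ → ℝ, Continuous g → (∀ a, η₀ ≤ a → g a = 0) →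
    ∀ f : V3 × V3 × V3 → ℝ, Continuous f → HasCompactSupport f →
    ∀ η δ : ℝ, 0 < η → 0 < δ → ∃ r₀ : ℝ, 0 < r₀ ∧ ∀ r : ℝ, 0 < r → r < r₀ →
    ∃ N₀ : ℕ, ∀ N : ℕ, N₀ ≤ N →
      localGibbsLaw σ a₀ u₀ θ₀ N (Φ N)
        {z | η < |pairStat σ N (Φ N) τ χ g f r z - pairStat σ N (Φ N) τ χ g (foreAft f) r z|} ≤
        ENNReal.ofReal δ

/-- Statement of `stub_collisionEnergyTails` — collisions involving a FAST particle carry vanishing normalised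
weight, uniformly in `N`: for every `θ > 0` there is a speed `L` beyond which the normalised count
`K_N[𝟙{‖v_i⁻‖ > L}]` of collisions whose (ordered-first) incoming particle is faster than `L` during `[0, τ]`
exceeds `θ` with probability at most `θ`. The collision-weighted sibling of the route's `KineticEnergyTails` /
`CollisionTightness` (a bound on `E (ε/(N+1)) Σ_collisions (|v⁻|² + |w⁻|²)` from energy conservation, the
virial / collisional-transfer identity and an entropy bound would give it by Chebyshev). -/
def CollisionEnergyTails : Prop :=
  ∀ (a₀ θ₀ : T3 → ℝ) (u₀ : T3 → V3), Continuous a₀ → Continuous θ₀ → Continuous u₀ →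
    (∀ x, 0 < a₀ x) → (∀ x, 0 < θ₀ x) → ∃ σ₀ : ℝ, 0 < σ₀ ∧ ∀ σ : ℝ, 0 < σ → σ < σ₀ →
    ∀ Φ : (N : ℕ) → Flow σ N, ∀ τ : ℝ, 0 < τ → ∀ θ : ℝ, 0 < θ →
    ∃ L : ℝ, ∃ N₀ : ℕ, ∀ N : ℕ, N₀ ≤ N →
      localGibbsLaw σ a₀ u₀ θ₀ N (Φ N)
        {z | θ < collSum σ N (Φ N) τ
          (fun z s i j => if L < ‖(preVel ((Φ N).flow s z) i j).1‖ then 1 else 0) z} ≤ ENNReal.ofReal θ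

/-- Statement of `stub_tubeRepresentation` — `(E)`-BOOKKEEPING, FORE–AFT COVARIANT: collision statistics are read
off the pair distribution near contact by the free-flight collision tube. Given the tails, for every bounded
continuous mark `m` and `η, δ > 0` there is ONE continuous compactly supported pair test function `f` (the
speed-truncated, grazing-trimmed, time-mollified forward tube: `f (y, v, w) ≈ φ_δ'(t*) · m(n̂*, v, w)`, `t*` the
free-flight time to contact of the pair at blown-up relative position `−y` with velocities `(v, w)`, `n̂*` the
contact direction, `∫ φ_δ' = 1`) such that, in probability as `N → ∞` at every fixed `r < r₀`:
(i) `K_N[χ g m] ≈ P_N[χ g f]` (each true collision is predicted by free flight from the configuration a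
micro-time `≤ δ'` earlier, up to three-body interference `O(δ')`, time-`0`/`τ` boundary layers `O(εδ'/τ)` and the
`εδ'`-modulus of continuity of `χ g(σ³ρ_r)` at fixed `r`); and (ii) `K_N^J[χ g m] ≈ P_N[χ g (f ∘ ρ₁)]` — the SAME
`f` reflected: reflecting positions and running free flight forward is running the true pair backward, so
`f ∘ ρ₁` fires on pairs that collided a micro-time `≤ δ'` AGO, reading them through `(−n̂, v⁺, w⁺) = J(pre)`. -/
def TubeRepresentation : Prop :=
  CollisionEnergyTails →
  ∀ (a₀ θ₀ : T3 → ℝ) (u₀ : T3 → V3), Continuous a₀ → Continuous θ₀ → Continuous u₀ →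
    (∀ x, 0 < a₀ x) → (∀ x, 0 < θ₀ x) → ∃ σ₀ : ℝ, 0 < σ₀ ∧ ∀ σ : ℝ, 0 < σ → σ < σ₀ →
    ∀ Φ : (N : ℕ) → Flow σ N, ∀ τ : ℝ, 0 < τ → ∀ χ : ℝ × T3 → ℝ, Continuous χ →
    ∀ g : ℝ → ℝ, Continuous g →
    ∀ m : V3 × V3 × V3 → ℝ, Continuous m → (∃ C : ℝ, ∀ q, |m q| ≤ C) →
    ∀ η δ : ℝ, 0 < η → 0 < δ →
    ∃ f : V3 × V3 × V3 → ℝ, Continuous f ∧ HasCompactSupport f ∧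
    ∃ r₀ : ℝ, 0 < r₀ ∧ ∀ r : ℝ, 0 < r → r < r₀ → ∃ N₀ : ℕ, ∀ N : ℕ, N₀ ≤ N →
      localGibbsLaw σ a₀ u₀ θ₀ N (Φ N)
          {z | η < |preStat σ N (Φ N) τ χ g m r z - pairStat σ N (Φ N) τ χ g f r z|} ≤ ENNReal.ofReal δ ∧
      localGibbsLaw σ a₀ u₀ θ₀ N (Φ N)
          {z | η < |revStat σ N (Φ N) τ χ g m r z - pairStat σ N (Φ N) τ χ g (foreAft f) r z|} ≤
        ENNReal.ofReal δ

/-! ## Registered stubs -/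

/-- STUB 1 (size XL / open; the route's balance node, imported): local Maxwellianity read through collisions —
the surprisal reweighting is asymptotically `× 2` on every bounded continuous mark. -/
theorem stub_localMaxwellReweighting : LocalMaxwellReweighting := by
  sorry

/-- STUB 2 (size XL / open; THE BET, HARDEST, the line's mechanism): fore–aft (`R̂ = PT`) symmetry of the
microscopic pair functional along forward local-Gibbs evolutions. Intended proof: space–time local states
(`rootedLocalState` / `localLawTimeAvg`) are tight with stationary, translation-invariant local weak cluster
points carried by Alexander's infinite flow (OVY 1993 Lemma 4.1-type); `R̂` maps that compact convex set to
itself and permutes ergodic components; the claim is that no cluster point of a FORWARD local-Gibbs evolution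
is handed (finite specific entropy / a.c. velocities are essential — triage r1-1's atomic-velocity
counterexample); pair functionals with `f ∈ C_c` are bounded vaguely continuous local functionals on hard-core
rooted configurations, so `R̂`-invariance passes to them. -/
theorem stub_pairForeAftSymmetry : PairForeAftSymmetry := by
  sorry

/-- STUB 3 (size M–L): collisions with a fast incoming particle are negligible in the normalised collision
count, uniformly in `N` (collision-weighted kinetic-energy tails). -/
theorem stub_collisionEnergyTails : CollisionEnergyTails := by
  sorry

/-- STUB 4 (size L; deterministic geometry + a third-body interference estimate in probability): the
fore–aft covariant free-flight TUBE representation of the pre-collisional and of the `J`-read collision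
statistics by one pair test function `f ∈ C_c` and its mirror `f ∘ ρ₁`. Tree inputs:
`HardSphereFlow.integral_empiricalCollisionMeasure_eq_finsum_ite` (the inline `K_N` is the integral against
the empirical collision measure on good data), `IsHardSphereTrajectory.free` / `.binary`, `reflectVel_*`,
`localGibbsLaw ≪ liouville` (`particleLaw`), card `equilibrium-rung-mean-variance`'s tube identity
(`tube_radius_J_invariant`, triage Check.lean). -/
theorem stub_tubeRepresentation : TubeRepresentation := by
  sorry

/-! ## Composition (sorry-free) -/

/-- For a `J`-odd mark the `J`-reading is minus the pre-collisional reading, collision by collision: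
`(v⁺, w⁺) = reflectVel n̂ (v⁻, w⁻)` with `‖n̂‖ = 1` on every contact term of `K_N` (`reflectVel_smul`,
`reflectVel_reflectVel`), so `Ψ(−n̂, v⁺, w⁺) = −Ψ(n̂, v⁻, w⁻)` by oddness; off contact both summands vanish. -/
theorem revStat_eq_neg_preStat {σ : ℝ} {N : ℕ} (hσ : 0 < σ) (Φ : Flow σ N) (τ : ℝ) (χ : ℝ × T3 → ℝ)
    (g : ℝ → ℝ) (Ψ : V3 × V3 × V3 → ℝ) (r : ℝ)
    (hodd : ∀ (n v w : V3), ‖n‖ = 1 → Ψ (-n, (reflectVel n (v, w)).1, (reflectVel n (v, w)).2) = -Ψ (n, v, w)) :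
    ∀ z, revStat σ N Φ τ χ g Ψ r z = -preStat σ N Φ τ χ g Ψ r z := by
  intro z
  have hε : 0 < hsDiameter σ N := hsDiameter_pos hσ N
  -- the pointwise identity on contact terms
  have key : ∀ (w : Cfg N) (i j : Fin (N + 1)), ‖G3.sepVec (w i).1 (w j).1‖ = hsDiameter σ N →
      Ψ (revData σ N w i j) = -Ψ (preData σ N w i j) := by
    intro w i j hnorm
    have hunit : ‖unitSep σ N w i j‖ = 1 := by
      rw [unitSep, norm_smul, Real.norm_eq_abs, abs_inv, abs_of_pos hε, hnorm, inv_mul_cancel₀ hε.ne']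
    have h12 : ((w i).2, (w j).2) =
        reflectVel (unitSep σ N w i j) ((preVel w i j).1, (preVel w i j).2) := by
      show ((w i).2, (w j).2) = reflectVel (unitSep σ N w i j) (preVel w i j)
      rw [unitSep, reflectVel_smul (inv_ne_zero hε.ne'), preVel, reflectVel_reflectVel]
    have h1 : (w i).2 = (reflectVel (unitSep σ N w i j) ((preVel w i j).1, (preVel w i j).2)).1 :=
      congrArg Prod.fst h12
    have h2 : (w j).2 = (reflectVel (unitSep σ N w i j) ((preVel w i j).1, (preVel w i j).2)).2 :=
      congrArg Prod.snd h12
    calc Ψ (revData σ N w i j)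
        = Ψ (-unitSep σ N w i j, (reflectVel (unitSep σ N w i j) ((preVel w i j).1, (preVel w i j).2)).1,
            (reflectVel (unitSep σ N w i j) ((preVel w i j).1, (preVel w i j).2)).2) := by
          rw [revData, ← h1, ← h2]
      _ = -Ψ (preData σ N w i j) := hodd _ _ _ hunit
  -- push the sign through the normalisation, the `finsum`s and the finite sums
  simp only [revStat, preStat, collSum]
  rw [← mul_neg, ← finsum_neg_distrib]
  congr 1
  refine finsum_congr fun s => ?_
  rw [← finsum_neg_distrib]
  refine finsum_congr fun _ => ?_
  rw [← Finset.sum_neg_distrib]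
  refine Finset.sum_congr rfl fun i _ => ?_
  rw [← Finset.sum_neg_distrib]
  refine Finset.sum_congr rfl fun j _ => ?_
  split_ifs with hc
  · rw [key _ i j hc.2, mul_neg]
  · exact neg_zero.symm

/-- The four-event union bound behind the composition: if `Kʳ = −K` identically, then
`|D| ≤ |D − 2K| + |K − P₁| + |P₁ − P₂| + |Kʳ − P₂|`, so `{η < |D|}` is covered by the four deviation events at
levels `η/4, η/8, η/8, η/4` (total `3η/4 < η`). Outer-measure monotonicity and subadditivity only. -/
theorem measure_setOf_lt_abs_le {α : Type*} [MeasurableSpace α] (μ : Measure α)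
    (D K Kr P₁ P₂ : α → ℝ) {η : ℝ} (hη : 0 < η) {a b c d : ℝ≥0∞}
    (hKr : ∀ z, Kr z = -K z)
    (h₁ : μ {z | η / 4 < |D z - 2 * K z|} ≤ a)
    (h₂ : μ {z | η / 8 < |K z - P₁ z|} ≤ b)
    (h₃ : μ {z | η / 8 < |Kr z - P₂ z|} ≤ c)
    (h₄ : μ {z | η / 4 < |P₁ z - P₂ z|} ≤ d) :
    μ {z | η < |D z|} ≤ a + b + c + d := by
  have hsub : {z | η < |D z|} ⊆ (({z | η / 4 < |D z - 2 * K z|} ∪ {z | η / 8 < |K z - P₁ z|}) ∪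
      {z | η / 8 < |Kr z - P₂ z|}) ∪ {z | η / 4 < |P₁ z - P₂ z|} := by
    intro z hz
    simp only [Set.mem_setOf_eq, Set.mem_union] at hz ⊢
    by_contra hcon
    push Not at hcon
    obtain ⟨⟨⟨hc1, hc2⟩, hc3⟩, hc4⟩ := hcon
    have e1 : |D z| ≤ |D z - 2 * K z| + |2 * K z| := by
      have h := abs_add_le (D z - 2 * K z) (2 * K z)
      rwa [sub_add_cancel] at h
    have e2 : 2 * K z = (K z - P₁ z) + (P₁ z - P₂ z) + (P₂ z - Kr z) := by
      rw [hKr z]; ring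
    have e3 : |2 * K z| ≤ |K z - P₁ z| + |P₁ z - P₂ z| + |P₂ z - Kr z| := by
      rw [e2]
      exact (abs_add_le _ _).trans (add_le_add (abs_add_le _ _) le_rfl)
    have e4 : |P₂ z - Kr z| = |Kr z - P₂ z| := abs_sub_comm _ _
    linarith
  calc μ {z | η < |D z|}
      ≤ μ ((({z | η / 4 < |D z - 2 * K z|} ∪ {z | η / 8 < |K z - P₁ z|}) ∪
          {z | η / 8 < |Kr z - P₂ z|}) ∪ {z | η / 4 < |P₁ z - P₂ z|}) := measure_mono hsub
    _ ≤ μ (({z | η / 4 < |D z - 2 * K z|} ∪ {z | η / 8 < |K z - P₁ z|}) ∪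
          {z | η / 8 < |Kr z - P₂ z|}) + μ {z | η / 4 < |P₁ z - P₂ z|} := measure_union_le _ _
    _ ≤ μ ({z | η / 4 < |D z - 2 * K z|} ∪ {z | η / 8 < |K z - P₁ z|}) +
          μ {z | η / 8 < |Kr z - P₂ z|} + μ {z | η / 4 < |P₁ z - P₂ z|} :=
        add_le_add (measure_union_le _ _) le_rfl
    _ ≤ μ {z | η / 4 < |D z - 2 * K z|} + μ {z | η / 8 < |K z - P₁ z|} +
          μ {z | η / 8 < |Kr z - P₂ z|} + μ {z | η / 4 < |P₁ z - P₂ z|} :=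
        add_le_add (add_le_add (measure_union_le _ _) le_rfl) le_rfl
    _ ≤ a + b + c + d := add_le_add (add_le_add (add_le_add h₁ h₂) h₃) h₄

/-- `δ/4 + δ/4 + δ/4 + δ/4 = δ` in `ℝ≥0∞` for `δ ≥ 0`. -/
theorem ofReal_quarter_add_four {δ : ℝ} (hδ : 0 ≤ δ) :
    ENNReal.ofReal (δ / 4) + ENNReal.ofReal (δ / 4) + ENNReal.ofReal (δ / 4) + ENNReal.ofReal (δ / 4) =
      ENNReal.ofReal δ := by
  have h4 : (0 : ℝ) ≤ δ / 4 := by positivity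
  have h8 : (0 : ℝ) ≤ δ / 4 + δ / 4 := by positivity
  have h12 : (0 : ℝ) ≤ δ / 4 + δ / 4 + δ / 4 := by positivity
  rw [← ENNReal.ofReal_add h4 h4, ← ENNReal.ofReal_add h8 h4, ← ENNReal.ofReal_add h12 h4]
  congr 1
  ring

/-- **Composition of the line.** `(M)` reweighting + fore–aft pair symmetry + collision energy tails + the
fore–aft covariant tube representation give the crux in this file's vocabulary (the right-hand side of
`oddContactSymmetry_iff`, definitionally `OddContactSymmetry`): thresholds `η₀ := min`, `σ₀ := min`,
`r₀ := min`, `N₀ := max`; the `J`-reading of the odd mark is minus its pre-reading (`revStat_eq_neg_preStat`),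
and the four deviation events at `(η/4, η/8, η/8, η/4) × (δ/4)` cover `{η < |K_N[χ g Ψ (1+e^{−F})]|}`. -/
theorem oddContactSymmetry_of_parts (hM : LocalMaxwellReweighting) (hS : PairForeAftSymmetry)
    (hT : CollisionEnergyTails) (hR : TubeRepresentation) :
    ∃ η₀ : ℝ, 0 < η₀ ∧ ∀ (a₀ θ₀ : T3 → ℝ) (u₀ : T3 → V3), Continuous a₀ → Continuous θ₀ → Continuous u₀ →
      (∀ x, 0 < a₀ x) → (∀ x, 0 < θ₀ x) → ∃ σ₀ : ℝ, 0 < σ₀ ∧ ∀ σ : ℝ, 0 < σ → σ < σ₀ →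
      ∀ Φ : (N : ℕ) → Flow σ N, ∀ τ : ℝ, 0 < τ → ∀ χ : ℝ × T3 → ℝ, Continuous χ →
      ∀ g : ℝ → ℝ, Continuous g → (∀ a, η₀ ≤ a → g a = 0) →
      ∀ Ψ : V3 × V3 × V3 → ℝ, Continuous Ψ → (∃ C : ℝ, ∀ q, |Ψ q| ≤ C) →
      (∀ (n v w : V3), ‖n‖ = 1 → Ψ (-n, (reflectVel n (v, w)).1, (reflectVel n (v, w)).2) = -Ψ (n, v, w)) →
      ∀ η δ : ℝ, 0 < η → 0 < δ → ∃ r₀ : ℝ, 0 < r₀ ∧ ∀ r ϑ : ℝ, 0 < r → r < r₀ → 0 < ϑ → ϑ < r₀ →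
      ∃ N₀ : ℕ, ∀ N : ℕ, N₀ ≤ N →
        localGibbsLaw σ a₀ u₀ θ₀ N (Φ N) {z | η < |reweightedStat σ N (Φ N) τ χ g Ψ r ϑ z|} ≤
          ENNReal.ofReal δ := by
  obtain ⟨η₁, hη₁, hM⟩ := hM
  obtain ⟨η₂, hη₂, hS⟩ := hS
  have hR' := hR hT
  refine ⟨min η₁ η₂, lt_min hη₁ hη₂, ?_⟩
  intro a₀ θ₀ u₀ ha hθ hu ha0 hθ0
  obtain ⟨σ₁, hσ₁, hM⟩ := hM a₀ θ₀ u₀ ha hθ hu ha0 hθ0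
  obtain ⟨σ₂, hσ₂, hS⟩ := hS a₀ θ₀ u₀ ha hθ hu ha0 hθ0
  obtain ⟨σ₃, hσ₃, hR⟩ := hR' a₀ θ₀ u₀ ha hθ hu ha0 hθ0
  refine ⟨min σ₁ (min σ₂ σ₃), lt_min hσ₁ (lt_min hσ₂ hσ₃), ?_⟩
  intro σ hσ hσlt Φ τ hτ χ hχ g hg hg0 Ψ hΨ hΨb hodd η δ hη hδ
  have hσ₁' : σ < σ₁ := lt_of_lt_of_le hσlt (min_le_left _ _)
  have hσ₂' : σ < σ₂ := lt_of_lt_of_le hσlt ((min_le_right _ _).trans (min_le_left _ _))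
  have hσ₃' : σ < σ₃ := lt_of_lt_of_le hσlt ((min_le_right _ _).trans (min_le_right _ _))
  have hg₁ : ∀ a, η₁ ≤ a → g a = 0 := fun a h => hg0 a ((min_le_left _ _).trans h)
  have hg₂ : ∀ a, η₂ ≤ a → g a = 0 := fun a h => hg0 a ((min_le_right _ _).trans h)
  have hη4 : 0 < η / 4 := by positivity
  have hη8 : 0 < η / 8 := by positivity
  have hδ4 : 0 < δ / 4 := by positivity
  -- (M) at level (η/4, δ/4)
  obtain ⟨r₁, hr₁, hM⟩ := hM σ hσ hσ₁' Φ τ hτ χ hχ g hg hg₁ Ψ hΨ hΨb (η / 4) (δ / 4) hη4 hδ4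
  -- the tube representation at level (η/8, δ/4): one test function `f` and its mirror
  obtain ⟨f, hf, hfs, r₂, hr₂, hR⟩ := hR σ hσ hσ₃' Φ τ hτ χ hχ g hg Ψ hΨ hΨb (η / 8) (δ / 4) hη8 hδ4
  -- fore–aft symmetry for that `f` at level (η/4, δ/4)
  obtain ⟨r₃, hr₃, hS⟩ := hS σ hσ hσ₂' Φ τ hτ χ hχ g hg hg₂ f hf hfs (η / 4) (δ / 4) hη4 hδ4
  refine ⟨min r₁ (min r₂ r₃), lt_min hr₁ (lt_min hr₂ hr₃), ?_⟩
  intro r ϑ hr hrlt hϑ hϑlt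
  have hr₁' : r < r₁ := lt_of_lt_of_le hrlt (min_le_left _ _)
  have hr₂' : r < r₂ := lt_of_lt_of_le hrlt ((min_le_right _ _).trans (min_le_left _ _))
  have hr₃' : r < r₃ := lt_of_lt_of_le hrlt ((min_le_right _ _).trans (min_le_right _ _))
  have hϑ₁ : ϑ < r₁ := lt_of_lt_of_le hϑlt (min_le_left _ _)
  obtain ⟨N₁, hN₁⟩ := hM r ϑ hr hr₁' hϑ hϑ₁
  obtain ⟨N₂, hN₂⟩ := hR r hr hr₂'
  obtain ⟨N₃, hN₃⟩ := hS r hr hr₃'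
  refine ⟨max N₁ (max N₂ N₃), fun N hN => ?_⟩
  have h1 := hN₁ N ((le_max_left _ _).trans hN)
  obtain ⟨h2, h3⟩ := hN₂ N (((le_max_left _ _).trans (le_max_right _ _)).trans hN)
  have h4 := hN₃ N (((le_max_right _ _).trans (le_max_right _ _)).trans hN)
  have hrev := revStat_eq_neg_preStat hσ (Φ N) τ χ g Ψ r hodd
  calc localGibbsLaw σ a₀ u₀ θ₀ N (Φ N) {z | η < |reweightedStat σ N (Φ N) τ χ g Ψ r ϑ z|}
      ≤ ENNReal.ofReal (δ / 4) + ENNReal.ofReal (δ / 4) + ENNReal.ofReal (δ / 4) + ENNReal.ofReal (δ / 4) :=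
        measure_setOf_lt_abs_le (localGibbsLaw σ a₀ u₀ θ₀ N (Φ N))
          (reweightedStat σ N (Φ N) τ χ g Ψ r ϑ) (preStat σ N (Φ N) τ χ g Ψ r) (revStat σ N (Φ N) τ χ g Ψ r)
          (pairStat σ N (Φ N) τ χ g f r) (pairStat σ N (Φ N) τ χ g (foreAft f) r) hη hrev h1 h2 h3 h4
    _ = ENNReal.ofReal δ := ofReal_quarter_add_four hδ.le

/-- **The skeleton concludes the crux BY NAME.** `JParityClosure.OddContactSymmetry`
(stmt-AtomisticToContinuum-13078) from the four registered stubs. -/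
theorem OddContactSymmetry_of : JParityClosure.OddContactSymmetry :=
  oddContactSymmetry_iff.2 (oddContactSymmetry_of_parts stub_localMaxwellReweighting stub_pairForeAftSymmetry
    stub_collisionEnergyTails stub_tubeRepresentation)

end Summit.AtomisticToContinuum.HydrodynamicLimit.Cruxes.OddContactSymmetry.PtShadowFluxDetailedBalance

end
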